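import Summits.MatrixMultiplication.MatrixMultiplication.Theorems.SoloInformedCwTwoLevelOrient
import Summits.MatrixMultiplication.MatrixMultiplication.Theorems.SoloInformedCwTwoOnePairOrient

/-!
# CONJECTURE B1 — the dominant rigid type at two pairs (solo-informed, gen 13; CLAIMS c165–c167)

The first open case of Theorem B (HALF-ORIENT at `p = 2`), isolated by the rigidity anatomy (c165): a mixed
two-pair design whose pairs carry the dominant OBLIGATION RELATIONS
`s₀ + (s₁ + d₁) [+ t_j] = d₀ [+ t_i]` (pattern `(1,-1)` for pair `1`) and `s₀ + d₀ [+ t_l] = d₁ [+ t_k]` (pattern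
`(0,-1)` for pair `0`), each with at most one singleton involved, admits BOTH mixed orientations `TU` and `UT`.
Evidence: 88/88 on the hard bed and 115,361/115,361 planted designs (c166), no counterexample known.
It is recorded here as a typed target (`ConjectureB1`), together with the bookkeeping fact that two distinct
working orientations give the HALF-ORIENT bound at two pairs.

Standard axioms only.
-/

namespace Summit.MatrixMultiplication.MatrixMultiplication.Theorems

open Finset

/-- CONJECTURE B1 (c165/c166): dominant-type rigid two-pair designs admit both mixed orientations
(`true` = the pair is oriented `U`). -/
def ConjectureB1 : Prop :=
  ∀ {q : ℕ} (s d : Fin 2 → ℕ) (t : Fin q → ℕ), IsMixedDesign s d t →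
    ∀ A B A' B' : Finset (Fin q), A.card + B.card ≤ 1 → A'.card + B'.card ≤ 1 →
      s 0 + (s 1 + d 1) + subsetSum t B = d 0 + subsetSum t A →
      s 0 + d 0 + subsetSum t B' = d 1 + subsetSum t A' →
      OrientedHallSix s d t ![false, true] ∧ OrientedHallSix s d t ![true, false]

/-- Two distinct working orientations. -/
theorem two_le_workingOrientations {p q : ℕ} (s d : Fin p → ℕ) (t : Fin q → ℕ) (o₁ o₂ : Fin p → Bool)
    (hne : o₁ ≠ o₂) (h₁ : OrientedHallSix s d t o₁) (h₂ : OrientedHallSix s d t o₂) :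
    2 ≤ workingOrientations s d t := by
  classical
  unfold workingOrientations
  exact Finset.one_lt_card.2 ⟨o₁, by simpa using h₁, o₂, by simpa using h₂, hne⟩

/-- CONJECTURE B1 gives the HALF-ORIENT bound `2 ^ 2 ≤ 2 · #W` on its designs. -/
theorem halfOrient_two_of_conjectureB1 (hB : ConjectureB1) {q : ℕ} (s d : Fin 2 → ℕ) (t : Fin q → ℕ)
    (hD : IsMixedDesign s d t) (A B A' B' : Finset (Fin q)) (hc : A.card + B.card ≤ 1)
    (hc' : A'.card + B'.card ≤ 1) (h₁ : s 0 + (s 1 + d 1) + subsetSum t B = d 0 + subsetSum t A)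
    (h₀ : s 0 + d 0 + subsetSum t B' = d 1 + subsetSum t A') :
    2 ^ 2 ≤ 2 * workingOrientations s d t := by
  obtain ⟨hTU, hUT⟩ := hB s d t hD A B A' B' hc hc' h₁ h₀
  have hne : (![false, true] : Fin 2 → Bool) ≠ ![true, false] := by
    intro h
    have := congrFun h 0
    simp at this
  have := two_le_workingOrientations s d t _ _ hne hTU hUT
  omega

end Summit.MatrixMultiplication.MatrixMultiplication.Theorems
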